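import Mathlib
import Literature.Computability.AlgebraicComplexity.GroupTheoreticMatMul
import Literature.Combinatorics.Additive.Kneser
import Summits.MatrixMultiplication.MatrixMultiplication.Theorems.GroupTheoreticSTPPCThesisPackingSumset
import Summits.MatrixMultiplication.MatrixMultiplication.Theorems.AbelianSTPPCensusIteratedRoom

/-!
# The room lemma through Kneser's theorem: rule U14-K (cell mm-stpp, theory g9)

A SHAPE-LEVEL necessary condition for census-STPP families (`IsSTPP`, CKSU 2005 Def. 5.1) in a finite abelian group
`G`, `|G| = M`, sharpening the cell's packing rule U14 (`STPPPackingSumset.sum_card_mul_add_card_sumset_le`, the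
set-level form: `Σ_{u ≠ t} |A_u||B_u| + |(A_t − B_t) + (C_t − C_t)| ≤ M`).  The room set is the sumset
`W_t − C_t = W_t + (−C_t)` of the `V_t`-set `W_t = A_t − B_t + C_t` (all sums distinct by the TPP, `V_t = |A_t||B_t||C_t|`)
and the `c_t`-set `−C_t`; Kneser's addition theorem (tree port `Literature.Combinatorics.Additive.add_kneser`) with
`K := Stab(W_t − C_t)` gives `|W_t + K| + |C_t + K| ≤ |W_t − C_t| + |K|`, where `|K|` divides `M` and all three sets
`W_t + K`, `C_t + K`, `W_t − C_t` are unions of `K`-cosets.  Hence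

**U14-K (C-form).**  For some divisor `d` of `M`:
`d·⌈V_t/d⌉ + d·⌈c_t/d⌉ ≤ d·⌊(M − Σ_{u≠t} a_u b_u)/d⌋ + d`
(`room_kneser_C`; A- and B-forms by the rotation `IsSTPP.rotate`).  With `d = 1` this reads
`V_t + Σ_{u≠t} a_u b_u + c_t ≤ M + 1`; so U14-K interpolates between vM's U14 (any slack) and the planner's tightness rule U14-T
(slack `0` ⇒ `d ∣ gcd(V_t, M)`, `d ≥ c_t`), and it bites exactly when the U14 slack is `< c_t − 1` and no subgroup order `d ∣ M`
rescues the count.  Kill schema for census instances: `false_of_roomKneser_C`, `_A`, `_B` (the divisor condition is a `decide` on the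
shape data), with one worked instance `no_766_666_666_666_at_362` — the ⊆-minimal list `(7,6,6)+(6,6,6)³`, alive under the
cell's shape sieve vP at the abelian order `362` (slack `2`), is impossible there (`362 = 2·181`; `d = 1, 2` fail by one and two
units, `d = 181, 362` grossly).  Numbers (seat note HOME/mm-stpp-theory/U14K-NOTE.md): U14-K kills none of the vP-alive `T_E` leaves
at orders `338–354` (slacks `≥ 15`) and `216` of the `678` recorded vP-alive `T_E` witness leaves at `358–420`.
WHAT THIS IS NOT: no `ω` statement; a necessary condition of the SAME KIND as the cell's sieve (a member sumset-cardinality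
bound, now with Kneser's period correction) — it does not move the first vP-alive order `338` and says nothing about existence there.
-/

-- single-conjunct summit: the mandated namespace repeats `MatrixMultiplication`.
set_option linter.dupNamespace false

namespace Summit.MatrixMultiplication.MatrixMultiplication.Theorems

namespace STPPRoomKneser

open Finset Literature.Computability.AlgebraicComplexity
open scoped Pointwise

variable {G : Type*} [AddCommGroup G] [DecidableEq G]

/-! ## Arithmetic of multiples -/

/-- If `d ∣ x` and `n ≤ x` then `d·⌈n/d⌉ ≤ x` (`⌈n/d⌉ = (n + d − 1)/d` for `0 < d`). [bookkeeping] -/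
theorem mul_ceilDiv_le_of_dvd {d x n : ℕ} (hd : 0 < d) (hdx : d ∣ x) (hnx : n ≤ x) :
    d * ((n + d - 1) / d) ≤ x := by
  obtain ⟨m, rfl⟩ := hdx
  refine Nat.mul_le_mul_left d ?_
  have h1 : (n + d - 1) / d < m + 1 := by
    rw [Nat.div_lt_iff_lt_mul hd, Nat.succ_mul]
    have : d * m = m * d := Nat.mul_comm d m
    omega
  omega

/-- If `d ∣ y` and `y ≤ R` then `y ≤ d·⌊R/d⌋`. [bookkeeping] -/
theorem le_mul_div_of_dvd {d y R : ℕ} (hd : 0 < d) (hdy : d ∣ y) (hyR : y ≤ R) :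
    y ≤ d * (R / d) := by
  obtain ⟨q, rfl⟩ := hdy
  refine Nat.mul_le_mul_left d ?_
  rw [Nat.le_div_iff_mul_le hd]
  rw [Nat.mul_comm] at hyR
  exact hyR

/-! ## Kneser on a sumset with a cardinality budget -/

/-- **Kneser with a budget.**  In a finite abelian group, if `X, Y` are non-empty and `|X + Y| ≤ R`, then for
`d := |Stab(X + Y)|` (a divisor of `|G|`): `d·⌈|X|/d⌉ + d·⌈|Y|/d⌉ ≤ d·⌊R/d⌋ + d`
(Kneser: `|X + K| + |Y + K| ≤ |X + Y| + |K|`, and `X + K ⊇ X`, `Y + K ⊇ Y`, `X + Y` are unions of `K`-cosets).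
[cite: Nathanson1996, Thm 4.3] -/
theorem kneser_budget [Fintype G] (X Y : Finset G) (hX : X.Nonempty) (hY : Y.Nonempty) (R : ℕ)
    (hXY : (X + Y).card ≤ R) :
    ∃ d : ℕ, d ∣ Fintype.card G ∧ 0 < d ∧
      d * ((X.card + d - 1) / d) + d * ((Y.card + d - 1) / d) ≤ d * (R / d) + d := by
  classical
  set K : Finset G := (X + Y).addStab with hK
  have hXYne : (X + Y).Nonempty := hX.add hY
  have hKne : K.Nonempty := hXYne.addStab
  have h0K : (0 : G) ∈ K := hXYne.zero_mem_addStab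
  refine ⟨K.card, hXYne.card_addStab_dvd_card_univ, hKne.card_pos, ?_⟩
  have hkn := Literature.Combinatorics.Additive.add_kneser (s := X) (t := Y)
  have hdX : K.card ∣ (X + K).card := card_addStab_dvd_card_add_addStab X (X + Y)
  have hdY : K.card ∣ (Y + K).card := card_addStab_dvd_card_add_addStab Y (X + Y)
  have hdXY : K.card ∣ (X + Y).card := card_addStab_dvd_card (X + Y)
  have hXsub : X.card ≤ (X + K).card := card_le_card (subset_add_left X h0K)
  have hYsub : Y.card ≤ (Y + K).card := card_le_card (subset_add_left Y h0K)
  have h1 := mul_ceilDiv_le_of_dvd hKne.card_pos hdX hXsub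
  have h2 := mul_ceilDiv_le_of_dvd hKne.card_pos hdY hYsub
  have h3 := le_mul_div_of_dvd hKne.card_pos hdXY hXY
  rw [← hK] at hkn
  omega

/-! ## The STPP application: rule U14-K -/

variable [Fintype G] {N : ℕ} {A B C : Fin N → Finset G}

/-- **U14-K, C-form.**  For an `IsSTPP` family with all sets non-empty in a finite abelian group `G`, and a member `t` with
`V = |A_t||B_t||C_t|`: for some divisor `d` of `|G|` (the order of the stabilizer of the room set `W_t − C_t`),
`d·⌈V/d⌉ + d·⌈|C_t|/d⌉ ≤ d·⌊(|G| − Σ_{u≠t}|A_u||B_u|)/d⌋ + d`. [original] -/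
theorem room_kneser_C (h : IsSTPP A B C) (hA : ∀ u, (A u).Nonempty) (hB : ∀ u, (B u).Nonempty)
    (hC : ∀ u, (C u).Nonempty) (t : Fin N) :
    ∃ d : ℕ, d ∣ Fintype.card G ∧ 0 < d ∧
      d * (((A t).card * (B t).card * (C t).card + d - 1) / d) + d * (((C t).card + d - 1) / d) ≤
        d * ((Fintype.card G - ∑ u ∈ univ.erase t, (A u).card * (B u).card) / d) + d := by
  classical
  set W := A t - B t + C t with hW
  have hV : W.card = (A t).card * (B t).card * (C t).card := STPPIteratedRoom.card_sub_add_eq h t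
  have hroom := STPPPackingSumset.sum_card_mul_add_card_sumset_le h hC t
  have hWC : W - C t = (A t - B t) + (C t - C t) := by
    rw [hW, sub_eq_add_neg (A t - B t + C t), add_assoc, ← sub_eq_add_neg (C t)]
  have hWne : W.Nonempty := ((hA t).sub (hB t)).add (hC t)
  have hneg : (-(C t)).Nonempty := (hC t).neg
  have hbudget : (W + -(C t)).card ≤ Fintype.card G - ∑ u ∈ univ.erase t, (A u).card * (B u).card := by
    rw [← sub_eq_add_neg, hWC]
    omega
  obtain ⟨d, hd, hdpos, hineq⟩ := kneser_budget W (-(C t)) hWne hneg _ hbudget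
  rw [card_neg, hV] at hineq
  exact ⟨d, hd, hdpos, hineq⟩

/-- **U14-K, A-form** (rotation `(A,B,C) ↦ (B,C,A)`): some `d ∣ |G|` has
`d·⌈V/d⌉ + d·⌈|A_t|/d⌉ ≤ d·⌊(|G| − Σ_{u≠t}|B_u||C_u|)/d⌋ + d`. [original] -/
theorem room_kneser_A (h : IsSTPP A B C) (hA : ∀ u, (A u).Nonempty) (hB : ∀ u, (B u).Nonempty)
    (hC : ∀ u, (C u).Nonempty) (t : Fin N) :
    ∃ d : ℕ, d ∣ Fintype.card G ∧ 0 < d ∧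
      d * (((A t).card * (B t).card * (C t).card + d - 1) / d) + d * (((A t).card + d - 1) / d) ≤
        d * ((Fintype.card G - ∑ u ∈ univ.erase t, (B u).card * (C u).card) / d) + d := by
  have e : (B t).card * (C t).card * (A t).card = (A t).card * (B t).card * (C t).card := by ring
  have := room_kneser_C h.rotate hB hC hA t
  rwa [e] at this

/-- **U14-K, B-form** (rotation `(A,B,C) ↦ (C,A,B)`): some `d ∣ |G|` has
`d·⌈V/d⌉ + d·⌈|B_t|/d⌉ ≤ d·⌊(|G| − Σ_{u≠t}|C_u||A_u|)/d⌋ + d`. [original] -/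
theorem room_kneser_B (h : IsSTPP A B C) (hA : ∀ u, (A u).Nonempty) (hB : ∀ u, (B u).Nonempty)
    (hC : ∀ u, (C u).Nonempty) (t : Fin N) :
    ∃ d : ℕ, d ∣ Fintype.card G ∧ 0 < d ∧
      d * (((A t).card * (B t).card * (C t).card + d - 1) / d) + d * (((B t).card + d - 1) / d) ≤
        d * ((Fintype.card G - ∑ u ∈ univ.erase t, (C u).card * (A u).card) / d) + d := by
  have e : (C t).card * (A t).card * (B t).card = (A t).card * (B t).card * (C t).card := by ring
  have := room_kneser_C h.rotate.rotate hC hA hB t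
  rwa [e] at this

/-! ## Kill schema on shape data -/

/-- **Kill schema, C-form.**  Shape data `a, b, c` of an `IsSTPP` family in an abelian group of order `M` (all sizes positive),
a member `t`, and `S = Σ_{u≠t} a_u b_u`: if NO divisor `d` of `M` satisfies
`d·⌈a_t b_t c_t/d⌉ + d·⌈c_t/d⌉ ≤ d·⌊(M − S)/d⌋ + d`, the family does not exist. [original] -/
theorem false_of_roomKneser_C (h : IsSTPP A B C) {a b c : Fin N → ℕ} (ha : ∀ r, (A r).card = a r)
    (hb : ∀ r, (B r).card = b r) (hc : ∀ r, (C r).card = c r) (hpos : ∀ r, 0 < a r ∧ 0 < b r ∧ 0 < c r)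
    {M : ℕ} (hM : Fintype.card G = M) (t : Fin N) (S : ℕ) (hS : S = ∑ u ∈ univ.erase t, a u * b u)
    (hkill : ∀ d ∈ M.divisors, d * ((M - S) / d) + d < d * ((a t * b t * c t + d - 1) / d) + d * ((c t + d - 1) / d)) :
    False := by
  classical
  have hA : ∀ u, (A u).Nonempty := fun u => card_pos.1 (by rw [ha u]; exact (hpos u).1)
  have hB : ∀ u, (B u).Nonempty := fun u => card_pos.1 (by rw [hb u]; exact (hpos u).2.1)
  have hC : ∀ u, (C u).Nonempty := fun u => card_pos.1 (by rw [hc u]; exact (hpos u).2.2)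
  obtain ⟨d, hd, hdpos, hineq⟩ := room_kneser_C h hA hB hC t
  have hMpos : M ≠ 0 := by rw [← hM]; exact Fintype.card_ne_zero
  have hdmem : d ∈ M.divisors := Nat.mem_divisors.2 ⟨by rw [← hM]; exact hd, hMpos⟩
  have hsum : ∑ u ∈ univ.erase t, (A u).card * (B u).card = S := by
    rw [hS]; exact sum_congr rfl fun u _ => by rw [ha u, hb u]
  rw [ha t, hb t, hc t, hM, hsum] at hineq
  exact absurd hineq (not_le.2 (hkill d hdmem))

/-- **Kill schema, A-form** (`S = Σ_{u≠t} b_u c_u`, small set `A_t`). [original] -/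
theorem false_of_roomKneser_A (h : IsSTPP A B C) {a b c : Fin N → ℕ} (ha : ∀ r, (A r).card = a r)
    (hb : ∀ r, (B r).card = b r) (hc : ∀ r, (C r).card = c r) (hpos : ∀ r, 0 < a r ∧ 0 < b r ∧ 0 < c r)
    {M : ℕ} (hM : Fintype.card G = M) (t : Fin N) (S : ℕ) (hS : S = ∑ u ∈ univ.erase t, b u * c u)
    (hkill : ∀ d ∈ M.divisors, d * ((M - S) / d) + d < d * ((a t * b t * c t + d - 1) / d) + d * ((a t + d - 1) / d)) :
    False := by
  refine false_of_roomKneser_C h.rotate hb hc ha (fun r => ⟨(hpos r).2.1, (hpos r).2.2, (hpos r).1⟩) hM t S hS ?_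
  intro d hd
  have e : b t * c t * a t = a t * b t * c t := by ring
  rw [e]; exact hkill d hd

/-- **Kill schema, B-form** (`S = Σ_{u≠t} c_u a_u`, small set `B_t`). [original] -/
theorem false_of_roomKneser_B (h : IsSTPP A B C) {a b c : Fin N → ℕ} (ha : ∀ r, (A r).card = a r)
    (hb : ∀ r, (B r).card = b r) (hc : ∀ r, (C r).card = c r) (hpos : ∀ r, 0 < a r ∧ 0 < b r ∧ 0 < c r)
    {M : ℕ} (hM : Fintype.card G = M) (t : Fin N) (S : ℕ) (hS : S = ∑ u ∈ univ.erase t, c u * a u)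
    (hkill : ∀ d ∈ M.divisors, d * ((M - S) / d) + d < d * ((a t * b t * c t + d - 1) / d) + d * ((b t + d - 1) / d)) :
    False := by
  refine false_of_roomKneser_C h.rotate.rotate hc ha hb (fun r => ⟨(hpos r).2.2, (hpos r).1, (hpos r).2.1⟩) hM t S hS ?_
  intro d hd
  have e : c t * a t * b t = a t * b t * c t := by ring
  rw [e]; exact hkill d hd

/-! ## One worked instance beyond the vP instrument -/

/-- **Order 362, shapes `(7,6,6),(6,6,6),(6,6,6),(6,6,6)`: impossible.**  A ⊆-minimal multiset beating `τ = 5/2`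
(`252^{5/6} + 3·216^{5/6} ≈ 364.8 > 362`) that PASSES the cell's shape sieve vP at the abelian order `362` (U14 slack
`362 − 252 − 108 = 2` in all three rooms of member `0`), killed by U14-K: `362 = 2·181`, and `d = 1: 252 + 6 ≤ 254 + 1`,
`d = 2: 252 + 6 ≤ 254 + 2`, `d = 181: 362 + 181 ≤ 181 + 181`, `d = 362: 362 + 362 ≤ 0 + 362` all fail. [original] -/
theorem no_766_666_666_666_at_362 {A B C : Fin 4 → Finset G} (h : IsSTPP A B C)
    (hA : ∀ r, (A r).card = ![7, 6, 6, 6] r) (hB : ∀ r, (B r).card = ![6, 6, 6, 6] r)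
    (hC : ∀ r, (C r).card = ![6, 6, 6, 6] r) (hM : Fintype.card G = 362) : False :=
  false_of_roomKneser_C h hA hB hC (by decide) hM 0 108 (by decide) (by decide)

end STPPRoomKneser

end Summit.MatrixMultiplication.MatrixMultiplication.Theorems
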